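import Summits.FinalStateConjecture.FinalStateConjecture.Theses.RootDecompFinalChargeCells

/-!
# `RootDecompFinalChargeCells.BoundedSingleExitGlue` (stmt-FinalStateConjecture-28427) — proof

Stand-alone proof (imports only the route file) of the GLUE support item of the gen-1 split of
`RootDecompFinalChargeCells.BoundedSingleExit` (stmt-FinalStateConjecture-27603, the bounded censored
single-hole residual) into its five final-charge cells `SubextremalChargeExit` (K, stmt-28422),
`HeavyChargeDoor` (stmt-28423), `HeavyChargeExit` (L, stmt-28424), `LightChargeExit` (H, stmt-28425) and
`NoChargeExit` (N, stmt-28426): children ⟹ parent. Written by a planner lens seat of the decomp-fsc cell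
(lens-5 «finite range + asymptotic regime + bridge», generations 6 and 23; the in-HOME kernel version is
`FinalChargeCells.bounded_of_cells`, lens-5 g5) for a prover seat to file; re-proved here directly on the
tree decls without the lens's cell vocabulary.

Statement (the tree decl, BY NAME): `SubextremalChargeExit → HeavyChargeDoor → HeavyChargeExit →
LightChargeExit → NoChargeExit → BoundedSingleExit`.

Proof: the six decls share the same `let`-bound predicates `P` (the summit property of a datum), `Pw0`,
`Disp`, `Trap`, `Cens`, `Single`, `CenFinF` (the parent's cell 𝓒_B) and the children moreover the
final-charge predicates `Acc` (an honest final Bondi account exists), `KerrB` (the account lies in the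
sub-extremal Kerr range), `HeavyB` (the account is heavy, `A_f < 8π M_f²`) and `Hor` (a weakly-outer-trapped-free
exterior region outside the event horizon exists); the parent asks for a tame admissible exit through `P` at
every admissible `P`-exceptional datum of the cell 𝓒_B, the children ask for it on the sub-populations
`Acc ∧ KerrB`, `Acc ∧ ¬KerrB ∧ HeavyB ∧ Hor`, `Acc ∧ ¬KerrB ∧ HeavyB ∧ ¬Hor`, `Acc ∧ ¬KerrB ∧ ¬HeavyB` and `¬Acc`,
which exhaust 𝓒_B by excluded middle (four times, nested). Pure logic; no geometry is used.
-/

-- D-0017: single-problem summit, `Summit.<S>.<S>.…` by design (cf. lakefile `weak.linter.dupNamespace`).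
set_option linter.dupNamespace false

namespace Summit.FinalStateConjecture.FinalStateConjecture.Theorems.RootDecompFinalChargeCellsBoundedSingleExitGlue

/-- **Glue of the final-charge split** (stmt-FinalStateConjecture-28427, BY NAME): if the Kerr-range cell, the
heavy door, the heavy cell, the light cell and the no-account cell each admit tame admissible exits through the
summit property, then so does the whole bounded censored single-hole residual — the five cells exhaust it by
excluded middle on «an honest final account exists», then on «it lies in the Kerr range», then on «it is
heavy», then on «a trapped-free exterior region outside the horizon exists». -/
theorem boundedSingleExitGlue : Theses.RootDecompFinalChargeCells.BoundedSingleExitGlue := by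
  intro hK hDoor hL hH hN X _ _ _ _ _ _
  have hK' := hK X
  have hDoor' := hDoor X
  have hL' := hL X
  have hH' := hH X
  have hN' := hN X
  dsimp only at hK' hDoor' hL' hH' hN' ⊢
  intro d hd hnP hB
  exact (Classical.em _).elim
    (fun hAcc ↦ (Classical.em _).elim
      (fun hKerr ↦ hK' d hd hnP hB ⟨hAcc, hKerr⟩)
      fun hKerr ↦ (Classical.em _).elim
        (fun hHeavy ↦ (Classical.em _).elim
          (fun hHor ↦ hDoor' d hd hnP hB ⟨hAcc, hKerr, hHeavy, hHor⟩)
          fun hHor ↦ hL' d hd hnP hB ⟨hAcc, hKerr, hHeavy, hHor⟩)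
        fun hHeavy ↦ hH' d hd hnP hB ⟨hAcc, hKerr, hHeavy⟩)
    fun hAcc ↦ hN' d hd hnP hB hAcc

end Summit.FinalStateConjecture.FinalStateConjecture.Theorems.RootDecompFinalChargeCellsBoundedSingleExitGlue
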